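/-
Copyright (c) 2026 the pub-hodgecm-mathlib formalisation cell (harness21).  Prover seat hodgecm-mathlib-B-p10 (g27), 2026-09-01.  Generic organ for road «S3-tree»
(bricks T3∕T4; architect A-p16 (g28) census «S3» v2 §4): compact conjugation averages are insensitive to deep perturbations — rank-free form of ★ (V-deep).
-/
import Literature.NumberTheory.Automorphic.DilationThickeningGL2               -- ★ `exists_nhds_one_forall_conj_mem` (conjugation by a compact set is uniformly small)
import Literature.Topology.LocallyConstantCompactSupportUniform                 -- ★ F0P3-p01 (g13): `exists_nhds_one_forall_mul_eq_of_hasCompactSupport{,'}` (uniform smoothness)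
import Literature.NumberTheory.Automorphic.QuadraticLocalBaseChange             -- ★ `exists_exp_lt_of_mem_nhds` (valuation balls in `w.adicCompletion`)
import Mathlib.MeasureTheory.Integral.Bochner.Set
import HarnessLib

/-!
# Compact conjugation averages are insensitive to deep perturbations (any topological group); quantitative depth in subgroups of `GL_n(L_w)`
# (rank-free core of the rank-one (V-deep) «deep shell averages agree», for road «S3-tree» T3∕T4 on the `U(3)_v` tree)

Topic `NumberTheory/Automorphic`; namespace `Literature.NumberTheory.Automorphic`.  THEOREMS ONLY (no definition, no named fact, no instance, no notation, no `sorry`;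
net debt 0).  Cell `pub/hodgecm-mathlib`, F0∕P3a, crux H413 = `stmt-HodgeConjecture-24833`, line «N6nsGerm», last open stub `stub_N6nsS3` (ED. 1.15 `stub_N6nsS3id`, the
Labesse–Langlands ∕ Shalika-germ identity AT THE IDENTITY); road «S3-tree» (architect A-p16 (g28), census «S3» v2 §4 (R-T): T4 «deep-shell cancellation in the κ-combination
— twin of (Ψ2)∕(V-deep)», T3 «class values at window facets»).  This file is the GENERIC organ those bricks read on the `U(3)_v` tree: it is ★ (V-deep) p844449∕p844557
(seat B-p10 (g27), rank one: `U_w ≤ GL₂(L_w)`) with the `2 × 2` descent algebra REMOVED and `GL₂ ↦ GL_n`.  Seat B-p10 (g27).  HONEST LABEL: HC_CM is proved only modulo the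
printed citations (2 remaining named inputs hLiu418, h413) until rung 0 closes; S3 is a printed row today; nothing printed is asserted here (point-set topology on groups and
entrywise valuation balls).

THE MATHEMATICS.  For `f ∈ C_c^∞(G)` (locally constant, compact support) on a topological group `G` and `C ⊆ G` compact: `f` is uniformly left- and right-smooth (★
`exists_nhds_one_forall_mul_eq_of_hasCompactSupport{,'}`) and conjugation by `C` is uniformly small at `1` (★ `exists_nhds_one_forall_conj_mem`), so there is `V ∈ 𝓝 1` with
`f(k⁻¹ (y x y′) k) = f(k⁻¹ x k)` for all `k ∈ C`, ALL `x ∈ G` and `y, y′ ∈ V` — hence the compact averages `∫_C f(k⁻¹ · k)` do not see perturbations in `V` (§1).  When the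
perturbation comes through a continuous homomorphism `ψ : Γ → G` from a subgroup `Γ ≤ GL_n(L_w)` (a one-place model), `V` pulls back to a neighbourhood of `1 ∈ Γ`, and those
contain every `g` with `g ≡ 1 ≡ g⁻¹` ENTRYWISE modulo valuation `≤ exp(−j)` for `j` deep enough (§2: the units topology is `g ↦ (g, g⁻¹)` into `M_n × M_nᵐᵒᵖ`, and matrix
neighbourhoods of `1` contain entrywise `exp(−j)`-balls) — §3 is the composite the tree bricks consume: «past a depth `j(f, C, ψ)`, `∫_C f(k⁻¹ (x·ψ g) k) = ∫_C f(k⁻¹ x k)`».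

* §1 `exists_nhds_one_forall_conj_mul_eq`, `exists_nhds_one_forall_conj_mul_mul_eq`, `exists_nhds_one_forall_setIntegral_conj_mul_eq`.
* §2 `GLn.exists_forall_matrix_mem_of_mem_nhds_one`, `GLn.exists_depth_mem_of_mem_nhds_one` (any `n`; the `n = 2` instances are ★ p844429 §4).
* §3 `GLn.exists_depth_forall_conj_mul_eq`, `GLn.exists_depth_setIntegral_conj_mul_eq`.

## References
* [LabesseLanglands1979] J.-P. Labesse, R. P. Langlands, *L-indistinguishability for SL(2)*, Canad. J. Math. 31 (1979) 726–785: §2 (2.2) p. 9 («`f(a, b²v∕x; x, a+bu) = f(a₀, 0; x, a₀)`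
  for `b` small»).
* [BernsteinZelevinsky1976] I. N. Bernstein, A. V. Zelevinsky, *Representations of the group GL(n, F) where F is a non-archimedean local field*, Russian Math. Surveys 31 (1976): §1.1.
* [NeukirchANT1999] J. Neukirch, *Algebraic Number Theory* (1999), Ch. II §5 (5.3) (the higher unit groups are a neighbourhood basis).
-/

set_option autoImplicit false

noncomputable section

open scoped Matrix MatrixGroups Topology WithZero
open Matrix MeasureTheory NumberField IsDedekindDomain Filter Set

namespace Literature.NumberTheory.Automorphic

/-! ## §1 Compact conjugation averages do not see small perturbations (any topological group) -/

section Generic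

variable {G : Type*} [Group G] [TopologicalSpace G] [IsTopologicalGroup G] {Y : Type*} [Zero Y]

/-- **RIGHT perturbations**: for `f` locally constant with compact support and `C` compact there is `V ∈ 𝓝 1` with `f (k⁻¹ (x y) k) = f (k⁻¹ x k)` for all `k ∈ C`, all `x`
and all `y ∈ V` (uniform right-smoothness of `f` after conjugating `y` by the compact `C`). [cite: BernsteinZelevinsky1976, §1.1] [cite: LabesseLanglands1979, §2 (2.2) p. 9] -/
theorem exists_nhds_one_forall_conj_mul_eq (f : G → Y) (hf : IsLocallyConstant f) (hfs : HasCompactSupport f) {C : Set G} (hC : IsCompact C) :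
    ∃ V ∈ 𝓝 (1 : G), ∀ k ∈ C, ∀ x : G, ∀ y ∈ V, f (k⁻¹ * (x * y) * k) = f (k⁻¹ * x * k) := by
  obtain ⟨W, hW, hfW⟩ := Literature.Topology.exists_nhds_one_forall_mul_eq_of_hasCompactSupport hf hfs
  obtain ⟨V, hV, hconj⟩ := exists_nhds_one_forall_conj_mem hC hW
  refine ⟨V, hV, fun k hk x y hy => ?_⟩
  have hsplit : k⁻¹ * (x * y) * k = (k⁻¹ * x * k) * (k⁻¹ * y * k) := by group
  rw [hsplit, hfW _ _ (hconj k hk y hy)]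

/-- **TWO-SIDED perturbations**: same with `f (k⁻¹ (y x y′) k) = f (k⁻¹ x k)` for `y, y′ ∈ V` (uniform left- and right-smoothness). [cite: BernsteinZelevinsky1976, §1.1] -/
theorem exists_nhds_one_forall_conj_mul_mul_eq (f : G → Y) (hf : IsLocallyConstant f) (hfs : HasCompactSupport f) {C : Set G} (hC : IsCompact C) :
    ∃ V ∈ 𝓝 (1 : G), ∀ k ∈ C, ∀ x : G, ∀ y ∈ V, ∀ y' ∈ V, f (k⁻¹ * (y * x * y') * k) = f (k⁻¹ * x * k) := by
  obtain ⟨W, hW, hfW⟩ := Literature.Topology.exists_nhds_one_forall_mul_eq_of_hasCompactSupport hf hfs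
  obtain ⟨W', hW', hfW'⟩ := Literature.Topology.exists_nhds_one_forall_mul_eq_of_hasCompactSupport' hf hfs
  obtain ⟨V, hV, hconj⟩ := exists_nhds_one_forall_conj_mem hC (Filter.inter_mem hW hW')
  refine ⟨V, hV, fun k hk x y hy y' hy' => ?_⟩
  have hsplit : k⁻¹ * (y * x * y') * k = (k⁻¹ * y * k) * ((k⁻¹ * x * k) * (k⁻¹ * y' * k)) := by group
  rw [hsplit, hfW' _ _ (hconj k hk y hy).2, hfW _ _ (hconj k hk y' hy').1]

/-- **COMPACT AVERAGES**: the set integral `∫_C f(k⁻¹ x k)` is unchanged by a right perturbation `x ↦ x y`, `y ∈ V`. [cite: LabesseLanglands1979, §2 (2.2) p. 9] -/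
theorem exists_nhds_one_forall_setIntegral_conj_mul_eq [MeasurableSpace G] (ν : Measure G) (f : G → ℂ) (hf : IsLocallyConstant f) (hfs : HasCompactSupport f)
    {C : Set G} (hC : IsCompact C) (hCm : MeasurableSet C) :
    ∃ V ∈ 𝓝 (1 : G), ∀ x : G, ∀ y ∈ V, ∫ k in C, f (k⁻¹ * (x * y) * k) ∂ν = ∫ k in C, f (k⁻¹ * x * k) ∂ν := by
  obtain ⟨V, hV, h⟩ := exists_nhds_one_forall_conj_mul_eq f hf hfs hC
  exact ⟨V, hV, fun x y hy => setIntegral_congr_fun hCm fun k hk => h k hk x y hy⟩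

end Generic

/-! ## §2 Quantitative depth in subgroups of `GL_n(L_w)` (any `n`) -/

section GLn

variable (L : Type) [Field L] [NumberField L] (w₁ : HeightOneSpectrum (𝓞 L)) (n : ℕ)

/-- **ENTRYWISE BALLS ARE A NEIGHBOURHOOD BASIS AT `1` IN `M_n(L_w)`** (consequence form, any `n`): every neighbourhood of `1` contains an entrywise `exp(−j)`-ball.
[cite: NeukirchANT1999, Ch. II §5 (5.3)] -/
theorem GLn.exists_forall_matrix_mem_of_mem_nhds_one {u : Set (Matrix (Fin n) (Fin n) (w₁.adicCompletion L))}
    (hu : u ∈ 𝓝 (1 : Matrix (Fin n) (Fin n) (w₁.adicCompletion L))) :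
    ∃ j : ℕ, ∀ M : Matrix (Fin n) (Fin n) (w₁.adicCompletion L), (∀ i k, Valued.v ((M - 1) i k) ≤ WithZero.exp (-(j : ℤ))) → M ∈ u := by
  by_contra hcon
  push Not at hcon
  choose M hM hMu using hcon
  have ht : Tendsto M atTop (𝓝 (1 : Matrix (Fin n) (Fin n) (w₁.adicCompletion L))) := by
    refine tendsto_pi_nhds.2 fun i => tendsto_pi_nhds.2 fun k => ?_
    rw [tendsto_def]
    intro s hs
    obtain ⟨m, hm⟩ := UnitaryGroup.exists_exp_lt_of_mem_nhds w₁ hs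
    refine (eventually_gt_atTop m).mono fun j hj => hm _ ?_
    have h := hM j i k
    rw [Matrix.sub_apply] at h
    exact lt_of_le_of_lt h (WithZero.exp_lt_exp.2 (by omega))
  obtain ⟨j, hj⟩ := (ht.eventually hu).exists
  exact hMu j hj

/-- **QUANTITATIVE NEIGHBOURHOODS OF `1` IN A SUBGROUP OF `GL_n(L_w)`** (any `n`): for `V₁ ∈ 𝓝 1` in `↥Γ` there is a depth `j` such that every `g ∈ Γ` with `g ≡ 1` and
`g⁻¹ ≡ 1` entrywise modulo valuation `≤ exp(−j)` lies in `V₁` (units topology `g ↦ (g, g⁻¹)`). [cite: NeukirchANT1999, Ch. II §5 (5.3)] -/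
theorem GLn.exists_depth_mem_of_mem_nhds_one (Γ : Subgroup (GL (Fin n) (w₁.adicCompletion L))) {V₁ : Set ↥Γ} (hV₁ : V₁ ∈ 𝓝 (1 : ↥Γ)) :
    ∃ j : ℕ, ∀ g : ↥Γ, (∀ i k, Valued.v ((((g : GL (Fin n) (w₁.adicCompletion L)) : Matrix (Fin n) (Fin n) (w₁.adicCompletion L)) - 1) i k) ≤ WithZero.exp (-(j : ℤ))) →
      (∀ i k, Valued.v (((((g⁻¹ : ↥Γ) : GL (Fin n) (w₁.adicCompletion L)) : Matrix (Fin n) (Fin n) (w₁.adicCompletion L)) - 1) i k) ≤ WithZero.exp (-(j : ℤ))) →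
      g ∈ V₁ := by
  have hind : Topology.IsInducing (fun g : ↥Γ => Units.embedProduct (Matrix (Fin n) (Fin n) (w₁.adicCompletion L)) (g : GL (Fin n) (w₁.adicCompletion L))) :=
    Units.isInducing_embedProduct.comp Topology.IsInducing.subtypeVal
  rw [hind.nhds_eq_comap, Filter.mem_comap] at hV₁
  obtain ⟨B, hB, hBV⟩ := hV₁
  have h1 : Units.embedProduct (Matrix (Fin n) (Fin n) (w₁.adicCompletion L)) ((1 : ↥Γ) : GL (Fin n) (w₁.adicCompletion L)) =
      ((1 : Matrix (Fin n) (Fin n) (w₁.adicCompletion L)), MulOpposite.op 1) := by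
    rw [OneMemClass.coe_one, map_one, Prod.one_eq_mk, MulOpposite.op_one]
  rw [h1, mem_nhds_prod_iff] at hB
  obtain ⟨u, hu, u', hu', huu⟩ := hB
  have hu'' : MulOpposite.op ⁻¹' u' ∈ 𝓝 (1 : Matrix (Fin n) (Fin n) (w₁.adicCompletion L)) :=
    MulOpposite.continuous_op.continuousAt.preimage_mem_nhds (by rwa [MulOpposite.op_one] at hu')
  obtain ⟨j₁, hj₁⟩ := GLn.exists_forall_matrix_mem_of_mem_nhds_one L w₁ n hu
  obtain ⟨j₂, hj₂⟩ := GLn.exists_forall_matrix_mem_of_mem_nhds_one L w₁ n hu''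
  have hle₁ : WithZero.exp (-((max j₁ j₂ : ℕ) : ℤ)) ≤ WithZero.exp (-(j₁ : ℤ)) := WithZero.exp_le_exp.2 (by omega)
  have hle₂ : WithZero.exp (-((max j₁ j₂ : ℕ) : ℤ)) ≤ WithZero.exp (-(j₂ : ℤ)) := WithZero.exp_le_exp.2 (by omega)
  refine ⟨max j₁ j₂, fun g hg hg' => hBV ?_⟩
  show Units.embedProduct (Matrix (Fin n) (Fin n) (w₁.adicCompletion L)) (g : GL (Fin n) (w₁.adicCompletion L)) ∈ B
  rw [Units.embedProduct_apply]
  refine huu (Set.mk_mem_prod (hj₁ _ fun i k => (hg i k).trans hle₁) (hj₂ _ fun i k => ?_))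
  have h := hg' i k
  rw [Subgroup.coe_inv] at h
  exact h.trans hle₂

/-! ## §3 The composite: past a depth, compact conjugation averages do not see `ψ g` for `g ≡ 1` deep -/

variable {G : Type*} [Group G] [TopologicalSpace G] [IsTopologicalGroup G]

/-- **DEEP PERTURBATIONS THROUGH A ONE-PLACE MODEL ARE INVISIBLE POINTWISE**: for a continuous homomorphism `ψ : Γ → G` (`Γ ≤ GL_n(L_w)`), `f` locally constant with compact
support and `C ⊆ G` compact, there is a depth `j` with `f (k⁻¹ (x · ψ g) k) = f (k⁻¹ x k)` for all `k ∈ C`, all `x`, and every `g` with `g ≡ 1 ≡ g⁻¹` entrywise modulo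
`≤ exp(−j)`. [cite: LabesseLanglands1979, §2 (2.2) p. 9] [cite: BernsteinZelevinsky1976, §1.1] -/
theorem GLn.exists_depth_forall_conj_mul_eq (Γ : Subgroup (GL (Fin n) (w₁.adicCompletion L))) (ψ : ↥Γ →* G) (hψ : Continuous ψ)
    {Y : Type*} [Zero Y] (f : G → Y) (hf : IsLocallyConstant f) (hfs : HasCompactSupport f) {C : Set G} (hC : IsCompact C) :
    ∃ j : ℕ, ∀ k ∈ C, ∀ x : G, ∀ g : ↥Γ,
      (∀ i k, Valued.v ((((g : GL (Fin n) (w₁.adicCompletion L)) : Matrix (Fin n) (Fin n) (w₁.adicCompletion L)) - 1) i k) ≤ WithZero.exp (-(j : ℤ))) →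
      (∀ i k, Valued.v (((((g⁻¹ : ↥Γ) : GL (Fin n) (w₁.adicCompletion L)) : Matrix (Fin n) (Fin n) (w₁.adicCompletion L)) - 1) i k) ≤ WithZero.exp (-(j : ℤ))) →
      f (k⁻¹ * (x * ψ g) * k) = f (k⁻¹ * x * k) := by
  obtain ⟨V, hV, h⟩ := exists_nhds_one_forall_conj_mul_eq f hf hfs hC
  have hV₁ : ψ ⁻¹' V ∈ 𝓝 (1 : ↥Γ) := hψ.continuousAt.preimage_mem_nhds (by rwa [map_one])
  obtain ⟨j, hj⟩ := GLn.exists_depth_mem_of_mem_nhds_one L w₁ n Γ hV₁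
  exact ⟨j, fun k hk x g hg hg' => h k hk x (ψ g) (hj g hg hg')⟩

/-- **DEEP PERTURBATIONS ARE INVISIBLE TO COMPACT AVERAGES**: with `C` compact measurable, past the depth `j` of `GLn.exists_depth_forall_conj_mul_eq`,
`∫_C f(k⁻¹ (x · ψ g) k) dν = ∫_C f(k⁻¹ x k) dν` — the rank-free shape road «S3-tree» T4 reads on the `U(3)_v` tree (`ψ` the one-place model, `x` a shell element, `g` the quotient of
two shell elements with congruent descent data). [cite: LabesseLanglands1979, §2 (2.2) p. 9] -/
theorem GLn.exists_depth_setIntegral_conj_mul_eq (Γ : Subgroup (GL (Fin n) (w₁.adicCompletion L))) (ψ : ↥Γ →* G) (hψ : Continuous ψ)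
    [MeasurableSpace G] (ν : Measure G) (f : G → ℂ) (hf : IsLocallyConstant f) (hfs : HasCompactSupport f) {C : Set G} (hC : IsCompact C) (hCm : MeasurableSet C) :
    ∃ j : ℕ, ∀ x : G, ∀ g : ↥Γ,
      (∀ i k, Valued.v ((((g : GL (Fin n) (w₁.adicCompletion L)) : Matrix (Fin n) (Fin n) (w₁.adicCompletion L)) - 1) i k) ≤ WithZero.exp (-(j : ℤ))) →
      (∀ i k, Valued.v (((((g⁻¹ : ↥Γ) : GL (Fin n) (w₁.adicCompletion L)) : Matrix (Fin n) (Fin n) (w₁.adicCompletion L)) - 1) i k) ≤ WithZero.exp (-(j : ℤ))) →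
      ∫ k in C, f (k⁻¹ * (x * ψ g) * k) ∂ν = ∫ k in C, f (k⁻¹ * x * k) ∂ν := by
  obtain ⟨j, hj⟩ := GLn.exists_depth_forall_conj_mul_eq L w₁ n Γ ψ hψ f hf hfs hC
  exact ⟨j, fun x g hg hg' => setIntegral_congr_fun hCm fun k hk => hj k hk x g hg hg'⟩

end GLn

end Literature.NumberTheory.Automorphic

end
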